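import Summits.Ventures.HSemireg.PerfectComplexSigmaDoor
import Summits.Ventures.HSemireg.PerfectComplexChartSpread
import Summits.Ventures.HSemireg.HomComplexSigmaSingle
import Summits.Ventures.HSemireg.DerivedEquivalenceExtRank
import Summits.Ventures.HSemireg.HomComplexSigmaConj
import HarnessLib

/-!
# Venture HSemireg — links of the σ-door: (I) UPSTREAM, the σ-transfer follows from the local-deformation assumption of
# `PerfectComplexChartSpread.lean` at `Adm := sigmaAdmissible` (route (C)'s ONE assumption by name, printed étale-neighbourhood shape,
# on the real σ-carrier) and the composed `g = 6` / `g = 4` σ-chain; (II) DOWNSTREAM, a simple `I`-semiregular vector bundle `E₀`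
# IS a σ-admissible complex `E₀[0]` (consistency with Buchweitz–Flenner's printed hypothesis, via the column anchor)

HONEST FRAMING. Part of the Lean index of the computation cell `pub-hsemireg` (target seat t-7). Nothing here is a claim about
any explicit variety; nothing here says that HC / HC_CM / HC_AV holds; no Literature fact is declared; nothing is asserted about the
transfer `PerfectComplexSigmaTransfer C` (an assumption BY NAME of `PerfectComplexSigmaDoor.lean`).

WHAT THIS FILE ADDS. (I) UPSTREAM (theorems only). Seat th-3's `PerfectComplexChartSpread.lean` proves, for EVERY admissibility notion
`Adm`, «local algebraic deformation of an admissible complex over a smooth chart / an étale neighbourhood of `s₀` ⟹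
`PerfectComplexVariationalHodge C Adm`» (the algebraisation/spread step, kernel-checked).  At `Adm := sigmaAdmissible`:
`PerfectComplexDeformsOverSmoothChart.perfectComplexSigmaTransfer`, `PerfectComplexDeformsOverEtaleNbhd.perfectComplexSigmaTransfer` —
so the cell's ONE assumption by name for route (C) on the σ-carrier may be taken in the PRINTED étale-neighbourhood shape ([Perry2022] proof of Prop.
8.1; [Lieblich2006] 4.2.1; [Pridham2024Semiregularity]
Cor. 2.25 / Rem. 2.27) with the printed object hypothesis (perfect, `Ext^{<0} = 0`, simple, semiregular on the real `σ_q`), everything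
downstream kernel-checked (th-2's composition note, cell bus 2026-08-22T15:06:34Z (d)); and the COMPOSED forms
`weilSixfoldComponent_of_deformsOverEtaleNbhd_sigma_of_seedOn_member` (g = 6 cell) /
`weilFourfoldsSplit_of_reach_of_deformsOverEtaleNbhd_sigma_of_hyperbolicSeedOn` (g = 4): ONE assumption by name + Deligne's reach
(refereed) + a σ-seed by value ⟹ the conclusion, every intermediate step a tree theorem.

(II) DOWNSTREAM (theorems only). The K2 column anchor of seat gs-g4 (`HomComplexSigmaSingle.lean`: `isISemiregularC_single₀_iff` —
`I`-semiregularity of the single complex `E₀[0]` for the real `σ_q` IS the tree's module-level `IsISemiregular hE₀ I`, Buchweitz–Flenner's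
printed `I`-semiregularity of the sheaf `E₀`) and seat p6's `extRank_single_neg_eq_zero` (a sheaf has no negative self-extensions) give:
`sigmaAdmissible_single₀` — a finite locally free `E₀` with `{1..n} ⊆ I`, `Hom(E₀[0], E₀[0]) = ℂ` and `IsISemiregular hE₀ {q | q+1 ∈ I}`
has `E₀[0]` σ-admissible; `sigmaObjClass_single₀` — its Chern character is in `sigmaObjClass C n X₀ I`; `hasSeedOn_sigmaObjClass_of_sheaf`
— a Buchweitz–Flenner sheaf seed with `Hom = ℂ` and `{1..2n} ⊆ I` is a σ-door seed.  So ON VECTOR BUNDLES the σ-door's object hypothesis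
is the PRINTED hypothesis of [BuchweitzFlenner2003] Thm. 5.1 plus «simple» and «every degree `1..n` in `I`», and for such objects the
conclusion of the assumption `PerfectComplexSigmaTransfer C` is the conclusion of the refereed tree fact
`BuchweitzFlenner2003_variationalHodge_ISemiregular_model` at `E₀` — a consistency reading of the two hypothesis lists; no kernel implication
between the two `∀`-statements is constructed here, and nothing here proves the assumption.

(III) MODEL-INDEPENDENCE (appended; theorems + one `def`).  With `HomComplexSigmaConj.lean` (`isISemiregularC_iff_of_iso`: `σ_q` is invariant under
isomorphisms of strictly perfect complexes) the σ-admissibility notion is invariant under ISOMORPHISMS of complexes — `sigmaAdmissible_of_iso`,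
`sigmaAdmissible_iff_of_iso` (bounds, finite local freeness and the `Ext`-rank clauses transport; p4's `extRank_eq_of_quasiIso`) — and the sheaf
case loses its model restriction: `isoSingle₀OfIsZero` (a complex with zero terms off degree `0` is isomorphic to `E⁰[0]`),
`sigmaAdmissible_of_bfAdmissible` (p4's `bfAdmissible` ∧ `{1..n} ⊆ I` ∧ `Hom = ℂ` ⟹ `sigmaAdmissible`), `sigmaObjClass_of_bfAdmissible`.

NOT here: invariance under QUASI-isomorphisms of strictly perfect complexes — that is `HomComplexSigmaQuasiIso.lean` (seat gs-g4:
`isISemiregularC_iff_of_quasiIso`, `isISemiregularC_iff_of_roof`, inverting only `Q f`) and its door-level sequel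
`sigmaAdmissible_iff_of_quasiIso` (gs-g4's `PerfectComplexSigmaQuasiIso.lean`); any seed; any claim about the assumptions.
[cite: Perry2022, proof of Prop. 8.1] [cite: Lieblich2006, Thm. 4.2.1 and Prop. 2.1.9] [cite: Pridham2024Semiregularity, Cor. 2.25, Rem. 2.27]
[cite: BuchweitzFlenner2003, Def. 4.1, §5 (I-semiregular) and Thm. 5.1]
-/

noncomputable section

open CategoryTheory CategoryTheory.Limits AlgebraicGeometry

namespace Summit.Ventures.HSemireg

open Literature.AlgebraicGeometry Literature.AlgebraicGeometry.Motives Literature.AlgebraicGeometry.Modules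
open Literature.AlgebraicGeometry.HodgeTheory Literature.AlgebraicGeometry.KTheory
open Literature.AlgebraicTopology.SingularHomology

/-- **The σ-transfer from the smooth-chart deformation assumption**: local existence of an algebraic deformation of every
σ-admissible complex over a smooth chart (seat th-3's `PerfectComplexDeformsOverSmoothChart C sigmaAdmissible`, an ASSUMPTION BY
NAME) implies `PerfectComplexSigmaTransfer C` (th-3's spread theorem at `Adm := sigmaAdmissible`).
[cite: BuchweitzFlenner2003, §5, proof of Thm. 5.1] [cite: Lieblich2006, Thm. 4.2.1] [cite: Pridham2024Semiregularity, Cor. 2.25, Rem. 2.27] -/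
theorem PerfectComplexDeformsOverSmoothChart.perfectComplexSigmaTransfer {C : ChernCharacterBetti}
    (hD : PerfectComplexDeformsOverSmoothChart C sigmaAdmissible) : PerfectComplexSigmaTransfer C :=
  (perfectComplexSigmaTransfer_iff C).2 hD.perfectComplexVariationalHodge

/-- **The σ-transfer from the PRINTED étale-neighbourhood deformation assumption** (`PerfectComplexDeformsOverEtaleNbhd C
sigmaAdmissible`: over an étale neighbourhood of `s₀` every σ-admissible complex on the fibre deforms algebraically with the
prescribed Chern character — the shape of [Perry2022] proof of Prop. 8.1 / [Lieblich2006] 4.2.1 / [Pridham2024Semiregularity]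
Cor. 2.25, an ASSUMPTION BY NAME) — étale ⟹ chart ⟹ spread, all but the assumption kernel-checked.
[cite: Perry2022, proof of Prop. 8.1] [cite: Lieblich2006, Thm. 4.2.1] [cite: Pridham2024Semiregularity, Cor. 2.25, Rem. 2.27]
[claim: Perry2026Semiregularity, status: under-review] -/
theorem PerfectComplexDeformsOverEtaleNbhd.perfectComplexSigmaTransfer {C : ChernCharacterBetti}
    (h : PerfectComplexDeformsOverEtaleNbhd C sigmaAdmissible) : PerfectComplexSigmaTransfer C :=
  h.deformsOverSmoothChart.perfectComplexSigmaTransfer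

/-! ### (I, composed) The route-(C) σ-chain: ONE deformation assumption by name + Deligne's reach + a σ-seed by value -/

section Composed

open Literature.AlgebraicGeometry.VanGeemen1994
open Summit.HodgeConjecture.HodgeConjecture.Ring2.Hypotheses
open Summit.HodgeConjecture.HodgeConjecture.Ring2.AbelianAll
open Summit.HodgeConjecture.HodgeConjecture
open Summit.HodgeConjecture.HodgeConjecture.WeilTypeLadder
open Summit.HodgeConjecture.HodgeConjecture.Cruxes.HodgeAbelianVarieties.EStepSecantInduction
open Summit.Ventures.HSemireg.GeneralStructure

/-- **`g = 6`, route (C) on the σ-carrier, fully composed.**  Hypotheses BY NAME: `weilFamilyReach_similar` (Deligne, REFEREED fact) and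
`PerfectComplexDeformsOverEtaleNbhd C sigmaAdmissible` (the venture's ONE deformation-theoretic ASSUMPTION, printed étale-neighbourhood
shape, object hypothesis «perfect, `Ext^{<0} = 0`, simple, `(σ_q)_{q+1 ∈ I}` jointly injective» on the real `σ_q`).  Hypotheses BY VALUE: a
Weil-type `(3, d)` member of the sixfold cell `δ` with its Gram placement, a non-zero rational Weil class `w`, ONE σ-seed
`HasSeedOn (sigmaObjClass C) 3 P h_K w`.  Conclusion: `WeilClassesComponent 3 d δ`.  Everything between the assumption and the conclusion
(étale ⟹ chart ⟹ spread ⟹ local variational statement ⟹ anchor clause ⟹ cell) is kernel-checked; nothing is asserted; no row of the census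
supplies such a seed on a deciding component. [cite: Perry2022, proof of Prop. 8.1] [cite: Lieblich2006, Thm. 4.2.1]
[cite: Pridham2024Semiregularity, Cor. 2.25, Rem. 2.27] [cite: Deligne1982HodgeCycles, proof of Thm. 4.8]
[claim: Perry2026Semiregularity, status: under-review] -/
theorem weilSixfoldComponent_of_deformsOverEtaleNbhd_sigma_of_seedOn_member (C : ChernCharacterBetti) {d : ℕ}
    {δ : weilNormResidueGroup d} (hF : weilFamilyReach_similar) (hD : PerfectComplexDeformsOverEtaleNbhd C sigmaAdmissible)
    {P : AbelianVariety ℂ} {ψ₀ : P ⟶ P} (hW : IsWeilType P ψ₀ 3 d) (e : ProjectiveEmbedding P.X)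
    {a : complexBetti (projectiveSpace e.n ℂ) 2} (haQ : IsRationalClass a) (ha0 : a ≠ 0)
    (hδ : HasWeilDiscriminantNondeg P ψ₀ 3 d (symmetrisedClass d P ψ₀ e a) δ)
    {w : complexBetti P.X 6} (hwW : w ∈ weilClassesOf P ψ₀ 3 d) (hwQ : IsRationalClass w) (hw0 : w ≠ 0)
    (hS : HasSeedOn (sigmaObjClass C) 3 P (symmetrisedClass d P ψ₀ e a) w) :
    WeilClassesComponent 3 d δ :=
  weilSixfoldComponent_of_perfectComplexSigmaTransfer_of_seedOn_member C hF hD.perfectComplexSigmaTransfer hW e haQ ha0 hδ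
    hwW hwQ hw0 hS

/-- **`g = 4`, route (C) on the σ-carrier, fully composed**: `weilFamilyReach_hyperbolic` (refereed) ∧
`PerfectComplexDeformsOverEtaleNbhd C sigmaAdmissible` (the ONE assumption) ∧ `0 < d` ∧ ONE hyperbolic σ-seed on a split `ℚ(√-d)`-Weil
fourfold ⟹ `Stubs.WeilAlgebraicSplitHyperplane 2 d` (the Weil classes of every abelian fourfold of the split component are algebraic — the
case in print, re-derived; nothing about non-split components). [cite: Perry2022, proof of Prop. 8.1] [cite: Lieblich2006, Thm. 4.2.1]
[cite: Pridham2024Semiregularity, Cor. 2.25, Rem. 2.27] [cite: Deligne1982HodgeCycles, proof of Thm. 4.8]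
[cite: Markman2023GeneralizedKummers, Theorem 1.3 (the case in print)] [claim: Perry2026Semiregularity, status: under-review] -/
theorem weilFourfoldsSplit_of_reach_of_deformsOverEtaleNbhd_sigma_of_hyperbolicSeedOn {C : ChernCharacterBetti}
    (hF : weilFamilyReach_hyperbolic) (hD : PerfectComplexDeformsOverEtaleNbhd C sigmaAdmissible) {d : ℕ} (hd : 0 < d)
    (hS : HasHyperbolicSeedOn (sigmaObjClass C) 2 d) : Stubs.WeilAlgebraicSplitHyperplane 2 d :=
  weilFourfoldsSplit_of_reach_of_perfectComplexSigmaTransfer_of_hyperbolicSeedOn hF hD.perfectComplexSigmaTransfer hd hS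

end Composed

/-! ### (II) Downstream: simple `I`-semiregular vector bundles are σ-admissible -/

/-- **A simple `I`-semiregular vector bundle, as the complex `E₀[0]`, is σ-admissible.**  Clause (i) is the hypothesis
`{1..n} ⊆ I`; `Ext^{k}(E₀[0], E₀[0]) = 0` for `k < 0` is p6's `extRank_single_neg_eq_zero` (a sheaf has no negative
self-extensions); `Hom = ℂ` is the hypothesis `h0`; and `IsISemiregularC X₀ E₀[0] 0 0 _ {q | q+1 ∈ I}` is the module-level
`IsISemiregular hE₀ {q | q+1 ∈ I}` by the K2 anchor `HomComplex.isISemiregularC_single₀_iff` (seat gs-g4).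
[cite: BuchweitzFlenner2003, §5 (I-semiregular)] [cite: Lieblich2006, Prop. 2.1.9] -/
theorem sigmaAdmissible_single₀ {n : ℕ} {X₀ : SchemeOver ℂ} {I : Finset ℕ} (E₀ : X₀.left.Modules)
    (hE₀ : IsFiniteLocallyFree E₀) (hI : ∀ p : ℕ, 1 ≤ p → p ≤ n → p ∈ I)
    (h0 : extRank X₀ (HomComplex.single₀ X₀.left E₀) 0 = 1) (hsr : IsISemiregular hE₀ {q | q + 1 ∈ I}) :
    sigmaAdmissible n X₀ I (HomComplex.single₀ X₀.left E₀) := by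
  letI := HasDerivedCategory.standard X₀.left.Modules
  have hK : ∀ p, IsFiniteLocallyFree ((HomComplex.single₀ X₀.left E₀).X p) :=
    (IsBoundedVBComplex.single E₀ hE₀ 0).isFiniteLocallyFree
  exact ⟨hI, fun k hk => extRank_single_neg_eq_zero E₀ hk, h0, 0, 0, inferInstance, inferInstance, hK,
    (HomComplex.isISemiregularC_single₀_iff X₀ E₀ hE₀ hK _).2 hsr⟩

/-- **The Chern character of a simple `I`-semiregular vector bundle is in the σ-door's object class** (`κ_p = C.ch_p E₀ =
ch_p(E₀[0])`, `chPerfect_single`). [cite: BuchweitzFlenner2003, §5 (I-semiregular)] [cite: Fulton1998, Example 3.2.3] -/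
theorem sigmaObjClass_single₀ (C : ChernCharacterBetti) {n : ℕ} {X₀ : SchemeOver ℂ} {I : Finset ℕ} (E₀ : X₀.left.Modules)
    (hE₀ : IsFiniteLocallyFree E₀) (hI : ∀ p : ℕ, 1 ≤ p → p ≤ n → p ∈ I)
    (h0 : extRank X₀ (HomComplex.single₀ X₀.left E₀) 0 = 1) (hsr : IsISemiregular hE₀ {q | q + 1 ∈ I}) :
    sigmaObjClass C n X₀ I (fun p => C.ch X₀ E₀ p) :=
  ⟨HomComplex.single₀ X₀.left E₀, IsBoundedVBComplex.single E₀ hE₀ 0, sigmaAdmissible_single₀ E₀ hE₀ hI h0 hsr,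
    fun p _ => (chPerfect_single C X₀ E₀ hE₀ (IsBoundedVBComplex.single E₀ hE₀ 0).isFiniteLocallyFree p).symm⟩

/-- **A Buchweitz–Flenner sheaf seed with `Hom = ℂ` is a σ-door seed.**  On the abelian variety `P` (relative dimension `2n`):
a finite locally free `E₀` with `{1..2n} ⊆ I`, `n ∈ I`, `Hom(E₀, E₀) = ℂ`, `IsISemiregular hE₀ {q | q+1 ∈ I}`, `ch_n(E₀) = q·hⁿ + w`
and `ch_p(E₀) = c_p·hᵖ` for `p ∈ I ∖ {n}` gives `HasSeedOn (sigmaObjClass C) n P h w` — so such a row may be filed through the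
σ-door `weilClassesComponent_of_perfectComplexSigmaTransfer_of_seedOn_member` as well as through the REFEREED sheaf door (the latter
is of course the one to cite; this theorem records that the σ-door's hypothesis restricted to sheaves is the printed one).
[cite: BuchweitzFlenner2003, §5 (I-semiregular) and Thm. 5.1] -/
theorem hasSeedOn_sigmaObjClass_of_sheaf (C : ChernCharacterBetti) {n : ℕ} {P : AbelianVariety ℂ} {h : complexBetti P.X 2}
    {w : complexBetti P.X (2 * n)} (I : Finset ℕ) (hI : ∀ p : ℕ, 1 ≤ p → p ≤ 2 * n → p ∈ I) (hn : n ∈ I)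
    (E₀ : P.X.left.Modules) (hE₀ : IsFiniteLocallyFree E₀)
    (h0 : extRank P.X (HomComplex.single₀ P.X.left E₀) 0 = 1) (hsr : IsISemiregular hE₀ {q | q + 1 ∈ I})
    (q : ℚ) (c : ℕ → ℚ) (hchn : C.ch P.X E₀ n = ((q : ℚ) : ℂ) • cupPowTwo h n + w)
    (hchp : ∀ p ∈ I, p ≠ n → C.ch P.X E₀ p = ((c p : ℚ) : ℂ) • cupPowTwo h p) :
    HasSeedOn (sigmaObjClass C) n P h w :=
  ⟨I, fun p => C.ch P.X E₀ p, q, c, hn, sigmaObjClass_single₀ C E₀ hE₀ hI h0 hsr, hchn, hchp⟩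

/-! ### (III) Model-independence of `sigmaAdmissible` along isomorphisms of complexes; BF-admissible complexes are σ-admissible -/

section Model

variable {n : ℕ} {X₀ : SchemeOver ℂ} {I : Finset ℕ}

/-- A cochain complex all of whose terms off degree `0` are zero objects is isomorphic to the single complex of its degree-`0` term.
[folklore] -/
def isoSingle₀OfIsZero (E : CochainComplex X₀.left.Modules ℤ) (hz : ∀ i : ℤ, i ≠ 0 → IsZero (E.X i)) :
    E ≅ HomComplex.single₀ X₀.left (E.X 0) :=
  HomologicalComplex.Hom.isoOfComponents
    (fun i => if hi : i = 0 then E.XIsoOfEq hi ≪≫ (HomologicalComplex.singleObjXIsoOfEq (ComplexShape.up ℤ) 0 (E.X 0) i hi).symm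
      else (hz i hi).iso (HomologicalComplex.isZero_single_obj_X (ComplexShape.up ℤ) 0 (E.X 0) i hi))
    (fun i j hij => by
      by_cases hj : j = 0
      · subst hj
        have hi : i ≠ 0 := by simp only [ComplexShape.up_Rel] at hij; omega
        exact (hz i hi).eq_of_src _ _
      · exact (HomologicalComplex.isZero_single_obj_X (ComplexShape.up ℤ) 0 (E.X 0) j hj).eq_of_tgt _ _)

/-- **`sigmaAdmissible` is invariant under isomorphisms of complexes**: the bounds, the finite local freeness of the terms and the
`Ext`-rank clauses transport along `e : E ≅ E'` (Mathlib `isStrictlyGE_of_iso`; p4's `extRank_eq_of_quasiIso`), and the semiregularity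
clause by `HomComplex.isISemiregularC_iff_of_iso` (`HomComplexSigmaConj.lean`). [cite: BuchweitzFlenner2003, §5 (I-semiregular)] -/
theorem sigmaAdmissible_of_iso {E E' : CochainComplex X₀.left.Modules ℤ} (e : E ≅ E') (h : sigmaAdmissible n X₀ I E) :
    sigmaAdmissible n X₀ I E' := by
  letI := HasDerivedCategory.standard X₀.left.Modules
  obtain ⟨hI, hneg, h0, a, b, _, _, hE, hσ⟩ := h
  have hE' : ∀ i, IsFiniteLocallyFree (E'.X i) := fun i =>
    isFiniteLocallyFree_of_iso ((HomologicalComplex.eval _ _ i).mapIso e) (hE i)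
  haveI := CochainComplex.isStrictlyGE_of_iso e a
  haveI := CochainComplex.isStrictlyLE_of_iso e b
  refine ⟨hI, fun k hk => ?_, ?_, a, b, inferInstance, inferInstance, hE', ?_⟩
  · rw [← extRank_eq_of_quasiIso X₀ e.hom k]; exact hneg k hk
  · rw [← extRank_eq_of_quasiIso X₀ e.hom 0]; exact h0
  · exact (HomComplex.isISemiregularC_iff_of_iso X₀ a b hE hE' e _).1 hσ

/-- `sigmaAdmissible` along an isomorphism, as an `iff`. [cite: BuchweitzFlenner2003, §5 (I-semiregular)] -/
theorem sigmaAdmissible_iff_of_iso {E E' : CochainComplex X₀.left.Modules ℤ} (e : E ≅ E') :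
    sigmaAdmissible n X₀ I E ↔ sigmaAdmissible n X₀ I E' :=
  ⟨sigmaAdmissible_of_iso e, sigmaAdmissible_of_iso e.symm⟩

/-- **A Buchweitz–Flenner-admissible complex with `Hom = ℂ` and `{1..n} ⊆ I` is σ-admissible**: `bfAdmissible` (seat p4: all terms off
degree `0` zero, the degree-`0` term a finite locally free `I`-semiregular sheaf) ⟹ `E ≅ E⁰[0]` (`isoSingle₀OfIsZero`) ⟹ σ-admissible by
`sigmaAdmissible_single₀` and `sigmaAdmissible_of_iso` — the sheaf case of the σ-door with no model restriction left.
[cite: BuchweitzFlenner2003, §5 (I-semiregular) and Thm. 5.1] -/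
theorem sigmaAdmissible_of_bfAdmissible {E : CochainComplex X₀.left.Modules ℤ} (hbf : bfAdmissible n X₀ I E)
    (hI : ∀ p : ℕ, 1 ≤ p → p ≤ n → p ∈ I) (h0 : extRank X₀ E 0 = 1) : sigmaAdmissible n X₀ I E := by
  obtain ⟨hE₀, hz, hsr⟩ := hbf
  let e := isoSingle₀OfIsZero E hz
  have h0' : extRank X₀ (HomComplex.single₀ X₀.left (E.X 0)) 0 = 1 := by
    rw [← extRank_eq_of_quasiIso X₀ e.hom 0]; exact h0
  exact sigmaAdmissible_of_iso e.symm (sigmaAdmissible_single₀ (E.X 0) hE₀ hI h0' hsr)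

/-- Hence the object class: a BF-admissible object with `Hom = ℂ` and `{1..n} ⊆ I` is in `sigmaObjClass C`.
[cite: BuchweitzFlenner2003, §5 (I-semiregular)] -/
theorem sigmaObjClass_of_bfAdmissible (C : ChernCharacterBetti) {κ : ∀ p : ℕ, complexBetti X₀ (2 * p)}
    (h : perfectObjClass C (fun n X₀ I E => bfAdmissible n X₀ I E ∧ (∀ p : ℕ, 1 ≤ p → p ≤ n → p ∈ I) ∧ extRank X₀ E 0 = 1)
      n X₀ I κ) : sigmaObjClass C n X₀ I κ := by
  obtain ⟨E, hE, ⟨hbf, hI, h0⟩, hκ⟩ := h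
  exact ⟨E, hE, sigmaAdmissible_of_bfAdmissible hbf hI h0, hκ⟩

end Model

end Summit.Ventures.HSemireg

end
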